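import Summits.BirchSwinnertonDyer.BirchSwinnertonDyer.Theorems.CountingDoorF2AtThreeSelmerTailDoor
import HarnessLib

/-!
# BirchSwinnertonDyer / CountingDoorF2AtThree — the MASTER DOOR: the first-moment door at `p` consumes
# EXACTLY a lower density of `{#Sel_p ≠ p³}`; at `p = 3`, «dens{#Sel₃(E_a) = 27} has upper density
# `< 5/6`» (Y), which BOTH the root-number crux I2 and the tail input Z imply

Route `route-BirchSwinnertonDyer-CountingDoorF2AtThree` (cell bsd-rank2; TWIN leaf
`PAdicBSDRankTwoPositiveProportion`; open XL cruxes I1 `SelmerThreeAverageLargeF2`, I2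
`RootNumberPlusLowerDensityLargeF2`). Seat bsd-rank2-rootno-p2 GEN 5 (lane B on crux I2,
stmt-BirchSwinnertonDyer-19441); sequel to `CountingDoorF2AtThreeSelmerTailDoor` (p558347).

THE OBSERVATION. On the `100 %` set «rank ≥ 2 ∧ #E(ℚ)[p] = 1» the Selmer size is `p^s` with `s ≥ 2`
(`Theorems.sq_le_card_selmerGroup_of_rank`, parity-free). The three-level count with
`f = min(#Sel_p, p⁴)` needs, besides the capped first moment `limsup avg f ≤ A`, only a set `W` of lower
density `κ` on which `f = p⁴` unless `#Sel_p = p²`; the LARGEST such set is `W = {#Sel_p ≠ p³}` itself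
(`s ≥ 2`, `s ≠ 2, 3` ⇒ `s ≥ 4`: `pow_four_le_card_selmerGroup_of_ne_sq_of_ne_cube`). Hence:

  MASTER DOOR (`hasPositiveLowerDensityOn_card_selmerGroup_eq_sq_of_cappedAverage_of_neCube`, any `p`):
  `100 %` good + `limsup avg min(#Sel_p, p⁴) ≤ A` + `liminf dens{#Sel_p ≠ p³} ≥ κ` + `A < p³ + (p⁴ − p³)κ`
  ⟹ `dens{#Sel_p = p²} ≥ (p³ + (p⁴ − p³)κ − A)/p⁴ > 0`.

Both landed doors are its corollaries, member by member: the ROOT-NUMBER door (eng-2's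
`hasPositiveLowerDensityOn_card_selmerGroup_eq_sq_of_cappedAverage`; `{w = +1} ⊆ {#Sel_p ≠ p³}` on the
good set by Dokchitser–Dokchitser parity, `densityOnGE_neCube_of_rootNumber`) and the TAIL door
(`…_of_tail`, p558347; `{p⁴ ≤ #Sel_p} ⊆ {#Sel_p ≠ p³}`, `densityOnGE_neCube_of_tail`); and partial inputs
ADD where ρ and ζ did not: `{w = +1}` and `{w = −1 ∧ p⁴ ≤ #Sel_p}` are disjoint subsets of `{#Sel_p ≠ p³}`
(`densityOnGE_neCube_of_rootNumber_add_oddTail`). At `p = 3`, `A = 36` the threshold `κ > 1/6` reads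

  (Y)  «in every large `Φ ⊆ F₂` with nonempty residue sets, the members with `#Sel₃(E_a) ≠ 27` have lower
       density `> 1/6`» — equivalently «`#Sel₃ = 27` has upper density `< 5/6`»,

the WEAKEST input the first-moment method can use (with `y = dens{#Sel₃ = 27} = 5/6`, `dens{≥ 81} = 1/6`,
`dens{9} = 0` the capped average is exactly `36`: nothing less than Y suffices) and the most ROBUST
numerically: Poonen–Rains quotient model `y = P(dim X = 1) = 0.479`, margin `0.354` below `5/6` (I2: `ρ = 1/2`
vs `1/6`; Z: `ζ = 0.2012` vs `1/6`); the `p = 2` analogue `dens{#Sel₂ = 8}` reads `.394/.446/.473` at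
`H < 10⁶/10⁷/10⁸` on the cell's exact census (model `.419`, `p = 2` threshold `1/2`).

* §1 `pow_four_le_card_selmerGroup_of_ne_sq_of_ne_cube` (parity-free level lemma).
* §2 the master door at `p` (density and positive-proportion forms) and at `3`
  (`hasPositiveLowerDensityOn_selmerNine_of_cappedAverage_of_neCube`, `A < 27 + 54κ`).
* §3 the three feeders of `κ`: parity (`densityOnGE_neCube_of_rootNumber`, mod D–D), tail
  (`densityOnGE_neCube_of_tail`), and parity + odd tail ADDED (`densityOnGE_neCube_of_rootNumber_add_oddTail`:
  `liminf dens{w = +1} ≥ ρ`, `liminf dens{w = −1 ∧ p⁴ ≤ #Sel_p} ≥ z` ⇒ `κ ≥ ρ + z`; disjoint lower densities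
  add, `densityOnGE_or_of_disjoint`).
* §4 BY NAME: `neCubeDensity_of_rootNumberPlusLowerDensityLargeF2` (LargeFamilyInputsF2 → D–D → I2 → Y),
  `neCubeDensity_of_selmerTail` (Z → Y, fact-free), `selmerNineDensity_of_cappedAverage_of_neCube`
  (LargeFamilyInputsF2 → I1cap → Y → D9), **`pAdicBSDRankTwoPositiveProportion_of_selmerThreeAverage_of_neCube :
  PublishedInputsAtThree → SelmerThreeAverageLargeF2 → Y → PAdicBSDRankTwoPositiveProportion`** (refined door
  family; `LargeFamilyInputsF2` not a hypothesis; D–D idle), and the FACT-FREE weak leaf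
  `weakLeaf_of_selmerThreeAverage_of_neCube`.

HONESTY. Y is OPEN like I2 and Z (any mechanism bounding `dens{#Sel₃ = 27}` away from `1` must see either a
sign (parity wall (wC), lane-B census) or a second Selmer class (Cohen–Lenstra side) on a positive proportion);
it is recorded because it is the EXACT consumption of the door, because it is implied by each of the two typed
inputs, and because partial sign and partial tail information add up inside it. Nothing here proves I1, I2, Y
or Z; nothing reads an analytic rank (B1); no S0 motion; BSD is not proved by any of this. THEOREMS ONLY (no
definition, no named fact beyond explicit hypotheses, no `sorry`); standard axioms. PARTITION: none — r_an ≥ 2,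
summit axis S0 (D-0036(1) funded rung); TWIN (D-0056): n/a.

References: M. Bhargava, A. Shankar, Ann. of Math. 181 (2015) §1 (first-moment method)
[BhargavaShankarTernary2015]; T. and V. Dokchitser, Ann. of Math. 172 (2010) Thm 1.4 (p-parity)
[DokchitserDokchitserAnnals2010]; B. Poonen, E. Rains, J. AMS 25 (2012) §2 (the distribution model)
[PoonenRains2012]; J. H. Silverman, *AEC* (2009) Thm X.4.2 [SilvermanAEC2009]; M. Bhargava, W. Ho,
arXiv:2207.03309 Thm. 1.1–1.3 [BhargavaHo2022].
-/

set_option linter.dupNamespace false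

noncomputable section

open scoped Classical
open Filter Topology Finset
open WeierstrassCurve Literature.NumberTheory.EllipticCurves
  Literature.NumberTheory.EllipticCurves.ModularForms CongruenceSubgroup
  Literature.NumberTheory.EllipticCurves.BhargavaHo2022
  Summit.BirchSwinnertonDyer.Rank2
  Summit.BirchSwinnertonDyer.BirchSwinnertonDyer.Theses.CountingDoorF2AtThree

namespace Summit.BirchSwinnertonDyer.BirchSwinnertonDyer.Theorems

/-! ### §1 The parity-free level lemma -/

section Levels

variable (W : WeierstrassCurve ℚ) [W.IsElliptic] (p : ℕ) [Fact p.Prime]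

/-- **`rank ≥ 2`, `#E(ℚ)[p] = 1`, `#Sel_p ≠ p²` and `#Sel_p ≠ p³` give `p⁴ ≤ #Sel_p(E)`** — NO parity:
`#Sel_p = p^s`, `s ≥ 2` (`sq_le_card_selmerGroup_of_rank`), `s ∉ {2, 3}`. [cite: SilvermanAEC2009, Thm X.4.2] -/
theorem pow_four_le_card_selmerGroup_of_ne_sq_of_ne_cube (h2 : 2 ≤ W.mordellWeilRank)
    (ht : Nat.card (AddSubgroup.torsionBy W.toAffine.Point (p : ℤ)) = 1)
    (hne2 : Nat.card (W.selmerGroup p) ≠ p ^ 2) (hne3 : Nat.card (W.selmerGroup p) ≠ p ^ 3) :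
    p ^ 4 ≤ Nat.card (W.selmerGroup p) := by
  have hp : p.Prime := Fact.out
  obtain ⟨s, hs⟩ := exists_natCard_selmerGroup_eq_pow W p
  have h2s : p ^ 2 ≤ p ^ s := hs ▸ sq_le_card_selmerGroup_of_rank W p h2 ht
  have hs2 : 2 ≤ s := (pow_le_pow_iff_right₀ hp.one_lt).mp h2s
  have hs2' : s ≠ 2 := fun h ↦ hne2 (by rw [hs, h])
  have hs3' : s ≠ 3 := fun h ↦ hne3 (by rw [hs, h])
  have hs4 : 4 ≤ s := by omega
  rw [hs]
  exact pow_le_pow_right₀ hp.one_le hs4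

end Levels

/-! ### §2 The master door at a prime `p` and at `3` -/

variable (Φ : CongruenceFamily₂)

/-- **The master door at `p`, density form — NO parity, NO tail.** On any `Φ ⊆ F₂`: a capped first moment
`limsup avg min(#Sel_p(E_a), p⁴) ≤ A` and a lower density `liminf dens{a : #Sel_p(E_a) ≠ p³} ≥ κ > 0` give
the members with `#Sel_p(E_a) = p²` (or outside the `100 %` set «rank ≥ 2 ∧ #E(ℚ)[p] = 1») lower density
`≥ (p³ + (p⁴ − p³)κ − A)/p⁴`: member-wise on the good set `min(#Sel_p, p⁴) = p⁴` on `{#Sel_p ≠ p³}` unless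
`#Sel_p = p²`, and `= p³` off it (`tail_counting_inequality` with `T = {#Sel_p ≠ p³}`).
[cite: BhargavaShankarTernary2015, §1 (first-moment method)] -/
theorem densityOnGE_card_selmerGroup_eq_sq_of_cappedAverage_of_neCube (p : ℕ) [Fact p.Prime] {A κ : ℝ}
    (hA : Φ.AverageOnLE (fun a ↦ min (Nat.card (a.curve.selmerGroup p) : ℝ) ((p : ℝ) ^ 4)) A)
    (hK : Φ.DensityOnGE (fun a ↦ Nat.card (a.curve.selmerGroup p) ≠ p ^ 3) κ) (hκ : 0 < κ) :
    Φ.DensityOnGE (fun a ↦ Nat.card (a.curve.selmerGroup p) = p ^ 2 ∨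
        ¬ (2 ≤ a.curve.mordellWeilRank ∧
          Nat.card (AddSubgroup.torsionBy a.curve.toAffine.Point (p : ℤ)) = 1))
      (((p : ℝ) ^ 3 + ((p : ℝ) ^ 4 - (p : ℝ) ^ 3) * κ - A) / (p : ℝ) ^ 4) := by
  have hp : p.Prime := Fact.out
  have hp0 : (0 : ℝ) < p := by exact_mod_cast hp.pos
  have hp1 : (1 : ℝ) ≤ p := by exact_mod_cast hp.one_lt.le
  have hp34 : (p : ℝ) ^ 3 ≤ (p : ℝ) ^ 4 := pow_le_pow_right₀ hp1 (by norm_num)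
  have hp04 : (0 : ℝ) < (p : ℝ) ^ 4 := by positivity
  have hB := eventually_card_below_pos_of_densityOnGE Φ hK hκ
  exact densityOnGE_of_counting_inequality Φ
    (f := fun a ↦ min (Nat.card (a.curve.selmerGroup p) : ℝ) ((p : ℝ) ^ 4))
    (W := fun a ↦ Nat.card (a.curve.selmerGroup p) ≠ p ^ 3 ∨ ¬ (2 ≤ a.curve.mordellWeilRank ∧
      Nat.card (AddSubgroup.torsionBy a.curve.toAffine.Point (p : ℤ)) = 1))
    (G := fun a ↦ Nat.card (a.curve.selmerGroup p) = p ^ 2 ∨ ¬ (2 ≤ a.curve.mordellWeilRank ∧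
      Nat.card (AddSubgroup.torsionBy a.curve.toAffine.Point (p : ℤ)) = 1))
    (c₀ := (p : ℝ) ^ 3) (c₁ := (p : ℝ) ^ 4 - (p : ℝ) ^ 3) (c₂ := (p : ℝ) ^ 4) (A := A) (ρ := κ)
    (by linarith) hp04
    (Filter.Eventually.of_forall fun X ↦
      tail_counting_inequality (Φ.below X)
        (fun a ↦ min (Nat.card (a.curve.selmerGroup p) : ℝ) ((p : ℝ) ^ 4))
        (fun a ↦ Nat.card (a.curve.selmerGroup p) ≠ p ^ 3 ∨ ¬ (2 ≤ a.curve.mordellWeilRank ∧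
          Nat.card (AddSubgroup.torsionBy a.curve.toAffine.Point (p : ℤ)) = 1))
        (fun a ↦ Nat.card (a.curve.selmerGroup p) = p ^ 2 ∨ ¬ (2 ≤ a.curve.mordellWeilRank ∧
          Nat.card (AddSubgroup.torsionBy a.curve.toAffine.Point (p : ℤ)) = 1))
        hp34
        (fun a _ ↦ le_min (Nat.cast_nonneg _) hp04.le)
        (by
          intro a ha hTa hGa
          obtain ⟨hne2, hgood⟩ := not_or.mp hGa
          obtain ⟨hrk, ht⟩ := not_not.mp hgood
          have hne3 := hTa.resolve_right hgood
          haveI : a.curve.IsElliptic := a.isElliptic_curve ((Φ.mem_below_iff a X).1 ha).1.1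
          have h4 := pow_four_le_card_selmerGroup_of_ne_sq_of_ne_cube a.curve p hrk ht hne2 hne3
          exact le_min (by exact_mod_cast h4) le_rfl)
        (by
          intro a _ hTa _
          obtain ⟨h3, -⟩ := not_or.mp hTa
          have h3' : Nat.card (a.curve.selmerGroup p) = p ^ 3 := not_not.mp h3
          refine le_min (by exact_mod_cast h3'.ge) hp34))
    hA (densityOnGE_mono Φ hK fun a h ↦ Or.inl h) hB

/-- **The master door at `p`, positive-proportion form.** On any `Φ ⊆ F₂` on which
`rank ≥ 2 ∧ #E(ℚ)[p] = 1` holds for `100 %`: `limsup avg min(#Sel_p, p⁴) ≤ A`,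
`liminf dens{#Sel_p ≠ p³} ≥ κ > 0` and `A < p³ + (p⁴ − p³)κ` give a POSITIVE LOWER DENSITY of members with
`#Sel_p(E_a) = p²` — no root number, no parity, no tail. [cite: BhargavaShankarTernary2015, §1 (first-moment method)] -/
theorem hasPositiveLowerDensityOn_card_selmerGroup_eq_sq_of_cappedAverage_of_neCube (p : ℕ) [Fact p.Prime]
    (hGood : Φ.HasDensityOn (fun a ↦ 2 ≤ a.curve.mordellWeilRank ∧
      Nat.card (AddSubgroup.torsionBy a.curve.toAffine.Point (p : ℤ)) = 1) 1)
    {A κ : ℝ}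
    (hA : Φ.AverageOnLE (fun a ↦ min (Nat.card (a.curve.selmerGroup p) : ℝ) ((p : ℝ) ^ 4)) A)
    (hK : Φ.DensityOnGE (fun a ↦ Nat.card (a.curve.selmerGroup p) ≠ p ^ 3) κ) (hκ : 0 < κ)
    (hAκ : A < (p : ℝ) ^ 3 + ((p : ℝ) ^ 4 - (p : ℝ) ^ 3) * κ) :
    Φ.HasPositiveLowerDensityOn (fun a ↦ Nat.card (a.curve.selmerGroup p) = p ^ 2) := by
  have hp : p.Prime := Fact.out
  have hp0 : (0 : ℝ) < p := by exact_mod_cast hp.pos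
  have hp04 : (0 : ℝ) < (p : ℝ) ^ 4 := by positivity
  have key := hasPositiveLowerDensityOn_of_densityOnGE Φ
    (densityOnGE_card_selmerGroup_eq_sq_of_cappedAverage_of_neCube Φ p hA hK hκ)
    (div_pos (by linarith) hp04)
  have key2 := hasPositiveLowerDensityOn_and_of_hasDensityOn_one Φ hGood key
  exact hasPositiveLowerDensityOn_mono Φ key2 fun a h ↦ h.2.resolve_right (not_not.mpr h.1)

/-- **At `p = 3` (input Y)**: on any `Φ ⊆ F₂` on which `rank ≥ 2 ∧ #E(ℚ)[3] = 1` holds for `100 %`, a capped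
average `limsup avg min(#Sel₃, 81) ≤ A`, a lower density `liminf dens{#Sel₃(E_a) ≠ 27} ≥ κ > 0` and
`A < 27 + 54κ` give a POSITIVE LOWER DENSITY of members with `#Sel₃(E_a) = 9`. With `A = 36`: `κ > 1/6`,
i.e. «`#Sel₃ = 27` has upper density `< 5/6`». [cite: BhargavaShankarTernary2015, §1 (first-moment method)] -/
theorem hasPositiveLowerDensityOn_selmerNine_of_cappedAverage_of_neCube
    (hGood : Φ.HasDensityOn (fun a ↦ 2 ≤ a.curve.mordellWeilRank ∧
      Nat.card (AddSubgroup.torsionBy a.curve.toAffine.Point (3 : ℤ)) = 1) 1)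
    {A κ : ℝ} (hA : Φ.AverageOnLE (fun a ↦ min (Nat.card (a.curve.selmerGroup 3) : ℝ) 81) A)
    (hK : Φ.DensityOnGE (fun a ↦ Nat.card (a.curve.selmerGroup 3) ≠ 27) κ) (hκ : 0 < κ)
    (hAκ : A < 27 + 54 * κ) :
    Φ.HasPositiveLowerDensityOn (fun a ↦ Nat.card (a.curve.selmerGroup 3) = 9) := by
  have h := hasPositiveLowerDensityOn_card_selmerGroup_eq_sq_of_cappedAverage_of_neCube Φ 3
    (by exact_mod_cast hGood) (A := A) (κ := κ) (by norm_num; exact hA) (by norm_num; exact hK) hκ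
    (by norm_num; linarith)
  norm_num at h
  exact h

/-! ### §3 The three feeders of `κ`: parity, tail, and parity + odd tail added -/

/-- **Member-wise: root number `+1` excludes `#Sel_p = p³`** on the good set (Dokchitser–Dokchitser
`p`-parity, K2: `w = +1 ⇒ #Sel_p ∈ {p², ≥ p⁴}`). [cite: DokchitserDokchitserAnnals2010, Thm 1.4 (p-parity)] -/
theorem card_selmerGroup_ne_cube_of_rootNumber_eq_one (W : WeierstrassCurve ℚ) [W.IsElliptic] (p : ℕ)
    [Fact p.Prime] (hDD : even_selmerRank_sub_torsionRank_iff) (h2 : 2 ≤ W.mordellWeilRank)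
    (ht : Nat.card (AddSubgroup.torsionBy W.toAffine.Point (p : ℤ)) = 1) (hw : W.rootNumber = 1) :
    Nat.card (W.selmerGroup p) ≠ p ^ 3 := by
  have hp : p.Prime := Fact.out
  intro h3
  have h34 : p ^ 3 < p ^ 4 := Nat.pow_lt_pow_right hp.one_lt (by norm_num)
  have h23 : p ^ 2 < p ^ 3 := Nat.pow_lt_pow_right hp.one_lt (by norm_num)
  have hne2 : Nat.card (W.selmerGroup p) ≠ p ^ 2 := by rw [h3]; exact h23.ne'
  have h4 := (card_selmerGroup_bounds_of_rootNumber W p hDD h2 ht).2 hw hne2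
  rw [h3] at h4
  exact absurd h4 (not_le.mpr h34)

/-- **Parity feeds the master door**: on a `Φ` on which `rank ≥ 2 ∧ #E(ℚ)[p] = 1` holds for `100 %`, a lower
density `ρ` of root number `+1` is a lower density of `{#Sel_p ≠ p³}` (the density-zero exceptional set is
absorbed by `densityOnGE_and` with the `100 %` set). So the root-number door
(`hasPositiveLowerDensityOn_card_selmerGroup_eq_sq_of_cappedAverage`) is the master door fed by parity.
[cite: DokchitserDokchitserAnnals2010, Thm 1.4 (p-parity)] -/
theorem densityOnGE_neCube_of_rootNumber (p : ℕ) [Fact p.Prime] (hDD : even_selmerRank_sub_torsionRank_iff)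
    (hGood : Φ.HasDensityOn (fun a ↦ 2 ≤ a.curve.mordellWeilRank ∧
      Nat.card (AddSubgroup.torsionBy a.curve.toAffine.Point (p : ℤ)) = 1) 1)
    {ρ : ℝ} (hW : Φ.DensityOnGE (fun a ↦ a.curve.rootNumber = 1) ρ) :
    Φ.DensityOnGE (fun a ↦ Nat.card (a.curve.selmerGroup p) ≠ p ^ 3) ρ := by
  have h : Φ.DensityOnGE (fun a ↦ a.curve.rootNumber = 1 ∧ (2 ≤ a.curve.mordellWeilRank ∧
      Nat.card (AddSubgroup.torsionBy a.curve.toAffine.Point (p : ℤ)) = 1)) ρ :=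
    densityOnGE_of_le Φ (densityOnGE_and Φ hW (densityOnGE_of_hasDensityOn Φ hGood)) (by linarith)
  refine densityOnGE_mono_mem Φ h fun a hmem hh ↦ ?_
  haveI : a.curve.IsElliptic := a.isElliptic_curve hmem.1
  exact card_selmerGroup_ne_cube_of_rootNumber_eq_one a.curve p hDD hh.2.1 hh.2.2 hh.1

/-- **The tail feeds the master door** (fact-free): `{p⁴ ≤ #Sel_p} ⊆ {#Sel_p ≠ p³}`, so a tail lower density
`ζ` is a lower density of `{#Sel_p ≠ p³}`; the tail door (`…_of_tail`) is the master door fed by the tail.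
[folklore] -/
theorem densityOnGE_neCube_of_tail (p : ℕ) [Fact p.Prime] {ζ : ℝ}
    (hZ : Φ.DensityOnGE (fun a ↦ p ^ 4 ≤ Nat.card (a.curve.selmerGroup p)) ζ) :
    Φ.DensityOnGE (fun a ↦ Nat.card (a.curve.selmerGroup p) ≠ p ^ 3) ζ := by
  have hp : p.Prime := Fact.out
  have h34 : p ^ 3 < p ^ 4 := Nat.pow_lt_pow_right hp.one_lt (by norm_num)
  exact densityOnGE_mono Φ hZ fun a h4 h3 ↦ absurd h4 (by rw [h3]; exact not_le.mpr h34)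

/-- **Disjoint lower densities add**: if no member satisfies both `P` and `Q`, then
`liminf dens(P ∨ Q) ≥ liminf dens P + liminf dens Q` (ε-forms; `#{P ∨ Q} = #{P} + #{Q}` ball by ball).
[folklore] -/
theorem densityOnGE_or_of_disjoint {P Q : Params → Prop} {δ₁ δ₂ : ℝ} (hP : Φ.DensityOnGE P δ₁)
    (hQ : Φ.DensityOnGE Q δ₂) (hdisj : ∀ a, Φ.Mem a → P a → ¬ Q a) :
    Φ.DensityOnGE (fun a ↦ P a ∨ Q a) (δ₁ + δ₂) := by
  intro ε hε
  filter_upwards [hP (ε / 2) (by linarith), hQ (ε / 2) (by linarith)] with X hPX hQX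
  have hsum : Φ.proportionOn (fun a ↦ P a ∨ Q a) X = Φ.proportionOn P X + Φ.proportionOn Q X := by
    rw [proportionOn_eq_card_filter_div, proportionOn_eq_card_filter_div,
      proportionOn_eq_card_filter_div, ← add_div]
    congr 1
    rw [Finset.filter_or, ← Nat.cast_add, Finset.card_union_of_disjoint]
    exact Finset.disjoint_filter.mpr fun a ha hPa hQa ↦
      hdisj a ((Φ.mem_below_iff a X).1 ha).1 hPa hQa
  rw [hsum]
  linarith

/-- **Parity and the ODD tail add inside the master door.** On a `Φ` on which `rank ≥ 2 ∧ #E(ℚ)[p] = 1`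
holds for `100 %`: lower densities `ρ` of `{w = +1}` and `z` of `{w = −1 ∧ p⁴ ≤ #Sel_p}` (disjoint) give
lower density `ρ + z` of `{#Sel_p ≠ p³}` — so the door opens as soon as `A < p³ + (p⁴ − p³)(ρ + z)`,
although `ρ` and the FULL tail `ζ` do not add (census B-β: they overlap in `{w = +1 ∧ p⁴ ≤ #Sel_p}`).
[cite: DokchitserDokchitserAnnals2010, Thm 1.4 (p-parity)] -/
theorem densityOnGE_neCube_of_rootNumber_add_oddTail (p : ℕ) [Fact p.Prime]
    (hDD : even_selmerRank_sub_torsionRank_iff)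
    (hGood : Φ.HasDensityOn (fun a ↦ 2 ≤ a.curve.mordellWeilRank ∧
      Nat.card (AddSubgroup.torsionBy a.curve.toAffine.Point (p : ℤ)) = 1) 1)
    {ρ z : ℝ} (hW : Φ.DensityOnGE (fun a ↦ a.curve.rootNumber = 1) ρ)
    (hT : Φ.DensityOnGE
      (fun a ↦ a.curve.rootNumber = -1 ∧ p ^ 4 ≤ Nat.card (a.curve.selmerGroup p)) z) :
    Φ.DensityOnGE (fun a ↦ Nat.card (a.curve.selmerGroup p) ≠ p ^ 3) (ρ + z) := by
  have hp : p.Prime := Fact.out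
  have h34 : p ^ 3 < p ^ 4 := Nat.pow_lt_pow_right hp.one_lt (by norm_num)
  have hA : Φ.DensityOnGE (fun a ↦ a.curve.rootNumber = 1 ∧ (2 ≤ a.curve.mordellWeilRank ∧
      Nat.card (AddSubgroup.torsionBy a.curve.toAffine.Point (p : ℤ)) = 1)) ρ :=
    densityOnGE_of_le Φ (densityOnGE_and Φ hW (densityOnGE_of_hasDensityOn Φ hGood)) (by linarith)
  have hAB := densityOnGE_or_of_disjoint Φ hA hT fun a _ hPa hQa ↦ by
    have h1 := hPa.1
    rw [hQa.1] at h1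
    norm_num at h1
  refine densityOnGE_mono_mem Φ hAB fun a hmem h ↦ ?_
  rcases h with hh | hh
  · haveI : a.curve.IsElliptic := a.isElliptic_curve hmem.1
    exact card_selmerGroup_ne_cube_of_rootNumber_eq_one a.curve p hDD hh.2.1 hh.2.2 hh.1
  · intro h3
    have h4 := hh.2
    rw [h3] at h4
    exact absurd h4 (not_le.mpr h34)

/-! ### §4 The chains BY NAME: I2 ⇒ Y, Z ⇒ Y, I1 (or I1cap) ∧ Y ⇒ D9 ⇒ leaf -/

/-- **I2 implies Y** (modulo the large-family facts and Dokchitser–Dokchitser `3`-parity): if on every large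
`Φ` with nonempty residue sets the root number is `+1` with lower density `ρ > 1/6`, then on every such `Φ`
the members with `#Sel₃(E_a) ≠ 27` have lower density `> 1/6` (`{w = +1} ⊆ {#Sel₃ ≠ 27}` on the `100 %`
set of I0 `Theorems.genericMembersLargeF2`). [cite: DokchitserDokchitserAnnals2010, Thm 1.4 (p-parity)] -/
theorem neCubeDensity_of_rootNumberPlusLowerDensityLargeF2 (hLF : LargeFamilyInputsF2)
    (hDD : even_selmerRank_sub_torsionRank_iff) (h2 : RootNumberPlusLowerDensityLargeF2)
    (Φ : CongruenceFamily₂) (hL : Φ.IsLarge) (hne : ∀ p : ℕ, p.Prime → (Φ.residues p).Nonempty) :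
    ∃ κ : ℝ, 1 / 6 < κ ∧ Φ.DensityOnGE (fun a ↦ Nat.card (a.curve.selmerGroup 3) ≠ 27) κ := by
  obtain ⟨ρ, hρ6, hW⟩ := h2 Φ hL hne
  have hGood := hasDensityOn_rank_torsionBy_of_torsionOrder Φ 3 (genericMembersLargeF2 hLF Φ hL hne)
  have h := densityOnGE_neCube_of_rootNumber Φ 3 hDD hGood hW
  exact ⟨ρ, hρ6, by norm_num at h; exact h⟩

/-- **Z implies Y** (fact-free): a tail density `dens{81 ≤ #Sel₃} > 1/6` on every large `Φ` with nonempty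
residue sets gives `dens{#Sel₃ ≠ 27} > 1/6` on every such `Φ`. [folklore] -/
theorem neCubeDensity_of_selmerTail
    (hZ : ∀ Φ : CongruenceFamily₂, Φ.IsLarge → (∀ p : ℕ, p.Prime → (Φ.residues p).Nonempty) →
      ∃ ζ : ℝ, 1 / 6 < ζ ∧ Φ.DensityOnGE (fun a ↦ 81 ≤ Nat.card (a.curve.selmerGroup 3)) ζ)
    (Φ : CongruenceFamily₂) (hL : Φ.IsLarge) (hne : ∀ p : ℕ, p.Prime → (Φ.residues p).Nonempty) :
    ∃ κ : ℝ, 1 / 6 < κ ∧ Φ.DensityOnGE (fun a ↦ Nat.card (a.curve.selmerGroup 3) ≠ 27) κ := by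
  obtain ⟨ζ, hζ6, hT⟩ := hZ Φ hL hne
  have h := densityOnGE_neCube_of_tail Φ 3 (ζ := ζ) (by norm_num; exact hT)
  exact ⟨ζ, hζ6, by norm_num at h; exact h⟩

/-- **D9 from the capped average and Y** (modulo the large-family facts only; no parity): I1cap and
«`dens{#Sel₃ ≠ 27} > 1/6` on every large `Φ` with nonempty residue sets» give the nine-density D9 on every
such `Φ`. [cite: BhargavaShankarTernary2015, §1 (first-moment method)] -/
theorem selmerNineDensity_of_cappedAverage_of_neCube (hLF : LargeFamilyInputsF2)
    (h1 : ∀ Φ : CongruenceFamily₂, Φ.IsLarge →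
      Φ.AverageOnLE (fun a ↦ min (Nat.card (a.curve.selmerGroup 3) : ℝ) 81) 36)
    (hY : ∀ Φ : CongruenceFamily₂, Φ.IsLarge → (∀ p : ℕ, p.Prime → (Φ.residues p).Nonempty) →
      ∃ κ : ℝ, 1 / 6 < κ ∧ Φ.DensityOnGE (fun a ↦ Nat.card (a.curve.selmerGroup 3) ≠ 27) κ)
    (Φ : CongruenceFamily₂) (hL : Φ.IsLarge) (hne : ∀ p : ℕ, p.Prime → (Φ.residues p).Nonempty) :
    Φ.HasPositiveLowerDensityOn (fun a ↦ Nat.card (a.curve.selmerGroup 3) = 9) := by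
  obtain ⟨κ, hκ6, hK⟩ := hY Φ hL hne
  have hGood := hasDensityOn_rank_torsionBy_of_torsionOrder Φ 3 (genericMembersLargeF2 hLF Φ hL hne)
  exact hasPositiveLowerDensityOn_selmerNine_of_cappedAverage_of_neCube Φ hGood (h1 Φ hL) hK
    (by linarith) (by linarith)

/-- **The leaf from the published inputs at `3`, the CAPPED `3`-Selmer average and Y** — no root number, no
parity, no tail, `LargeFamilyInputsF2` not a hypothesis (refined door family of
`Theorems.exists_refinedDoorFamily_densities`; the door's `36 < 27 + 54κ` iff `κ > 1/6`;
`Theorems.leaf_of_local_selmerNine` closes with Schneider/Perrin-Riou, Mazur–Tate `σ`, Skinner–Urban only).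
[cite: BhargavaShankarTernary2015, §1 (first-moment method); SkinnerUrban2014, Thm 3.29 (per-member door)] -/
theorem pAdicBSDRankTwoPositiveProportion_of_cappedAverage_of_neCube (hIn : PublishedInputsAtThree)
    (h1 : ∀ Φ : CongruenceFamily₂, Φ.IsLarge →
      Φ.AverageOnLE (fun a ↦ min (Nat.card (a.curve.selmerGroup 3) : ℝ) 81) 36)
    (hY : ∀ Φ : CongruenceFamily₂, Φ.IsLarge → (∀ p : ℕ, p.Prime → (Φ.residues p).Nonempty) →
      ∃ κ : ℝ, 1 / 6 < κ ∧ Φ.DensityOnGE (fun a ↦ Nat.card (a.curve.selmerGroup 3) ≠ 27) κ) :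
    PAdicBSDRankTwoPositiveProportion := by
  obtain ⟨Φ, hL, hne, hloc, hGen, hSchD⟩ := exists_refinedDoorFamily_densities
  obtain ⟨κ, hκ6, hK⟩ := hY Φ hL hne
  have hGood := hasDensityOn_rank_torsionBy_of_torsionOrder Φ 3 hGen
  have hD9 := hasPositiveLowerDensityOn_selmerNine_of_cappedAverage_of_neCube Φ hGood (h1 Φ hL) hK
    (by linarith) (by linarith)
  exact leaf_of_local_selmerNine Φ hL hloc hIn (hasDensityOn_one_mono Φ hGen fun _ h ↦ h.2) hSchD hD9

/-- **The leaf from the published inputs at `3`, I1 and Y** — the route's `Assembly` with the root-number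
crux I2 REPLACED by the weakest door input Y «`dens{#Sel₃ ≠ 27} > 1/6` on every large `Φ` with nonempty
residue sets» (implied by I2, `neCubeDensity_of_rootNumberPlusLowerDensityLargeF2`, and by Z,
`neCubeDensity_of_selmerTail`). [cite: BhargavaShankarTernary2015, §1 (first-moment method); SkinnerUrban2014, Thm 3.29 (per-member door)] -/
theorem pAdicBSDRankTwoPositiveProportion_of_selmerThreeAverage_of_neCube (hIn : PublishedInputsAtThree)
    (h1 : SelmerThreeAverageLargeF2)
    (hY : ∀ Φ : CongruenceFamily₂, Φ.IsLarge → (∀ p : ℕ, p.Prime → (Φ.residues p).Nonempty) →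
      ∃ κ : ℝ, 1 / 6 < κ ∧ Φ.DensityOnGE (fun a ↦ Nat.card (a.curve.selmerGroup 3) ≠ 27) κ) :
    PAdicBSDRankTwoPositiveProportion :=
  pAdicBSDRankTwoPositiveProportion_of_cappedAverage_of_neCube hIn
    (selmerThreeCappedAverage_of_selmerThreeAverageLargeF2 h1) hY

/-- **I1 and Y give the weak leaf on an explicit large family, FACT-FREE**: there is a large `Φ ⊆ F₂` with
nonempty residue sets in which the members with `rank E_a(ℚ) = 2 ∧ Ш(E_a)[3^∞] = 0` have positive lower
density — no published input whatsoever. [folklore] -/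
theorem weakLeaf_of_selmerThreeAverage_of_neCube (h1 : SelmerThreeAverageLargeF2)
    (hY : ∀ Φ : CongruenceFamily₂, Φ.IsLarge → (∀ p : ℕ, p.Prime → (Φ.residues p).Nonempty) →
      ∃ κ : ℝ, 1 / 6 < κ ∧ Φ.DensityOnGE (fun a ↦ Nat.card (a.curve.selmerGroup 3) ≠ 27) κ) :
    ∃ Φ : CongruenceFamily₂, Φ.IsLarge ∧ (∀ p : ℕ, p.Prime → (Φ.residues p).Nonempty) ∧
      Φ.HasPositiveLowerDensityOn (fun a ↦ a.IsMember ∧ a.curve.mordellWeilRank = 2 ∧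
        AddCommGroup.primaryComponent a.curve.sha 3 = ⊥) := by
  obtain ⟨Φ, hL, hne, -, hGen, -⟩ := exists_refinedDoorFamily_densities
  obtain ⟨κ, hκ6, hK⟩ := hY Φ hL hne
  have hGood := hasDensityOn_rank_torsionBy_of_torsionOrder Φ 3 hGen
  have hD9 := hasPositiveLowerDensityOn_selmerNine_of_cappedAverage_of_neCube Φ hGood
    (selmerThreeCappedAverage_of_selmerThreeAverageLargeF2 h1 Φ hL) hK (by linarith) (by linarith)
  have hD : Φ.HasPositiveLowerDensityOn (fun a ↦ Nat.card (a.curve.selmerGroup 3) = 3 ^ 2) :=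
    hasPositiveLowerDensityOn_mono Φ hD9 fun a h ↦ h.trans (by norm_num)
  exact ⟨Φ, hL, hne, hasPositiveLowerDensityOn_rank_two_sha_bot_of_card_selmerGroup_eq_sq Φ 3 hGood hD⟩

end Summit.BirchSwinnertonDyer.BirchSwinnertonDyer.Theorems

end
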